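import Summits.QuantumFields.QCD.Theorems.HeatSlicedQuarksQuarkLoopCoefficientHeatSeriesB

/-!
# Helper C for stub `stub_torusToPlane` (line `Sketch`, crux `QuarkLoopCoefficient`, item stmt-QuantumFields-16786): colour decoupling and the Dirac fibre identities

For a Cartan-diagonal `SU(3)` lattice gauge field `U` on the torus `(ℤ/L)⁴` (every link diagonal),
a colour `a`, and the colour-`a` link phases pulled back to the universal cover `ℤ⁴`,
`ũ_a (z̃, μ) = U(π z̃, μ)_{aa}` (`π : ℤ⁴ → (ℤ/L)⁴` the coordinatewise reduction):

* `castSite_add_single`, `castSite_add_deck`, `exists_deck_of_castSite_eq`, `deck_injective`,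
  `sum_fibre_sum`: the covering map, its deck group `Lℤ⁴` and its fibres;
* `wilsonDirac_apply_diag`: the torus Wilson–Dirac matrix `D_W(U, 0, 1)` is colour-diagonal, its
  colour-`a` block being the abelian Wilson kernel of the phases `u_a = U_{aa}` (`U⁻¹_{aa} = conj u_a`);
* `fibre_diracKer_row`, `fibre_diracKer_col`: the torus abelian kernel is the fibre sum of the `ℤ⁴`
  kernel `diracKer ũ_a` of `HeatSlicedQuarksQuarkLoopCoefficientDefs` (row and column versions; only
  `π (z̃ ± e_μ) = π z̃ ± e_μ` is used, so this holds for every `L`, including `L = 1, 2`);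
* `wilsonDirac_row`, `wilsonDirac_col`: the two combined.

Finite bookkeeping over the definition of `wilsonDirac`; Mathlib + the Defs/HeatSeries files.
-/

noncomputable section

namespace Summit.QuantumFields.QCD.Cruxes.QuarkLoopCoefficient.Sketch.TorusToPlane

open Summit.QuantumFields.QCD.Theorems.QuarkLoopCoefficient
open Literature.MathematicalPhysics.QuantumLattice Literature.MathematicalPhysics.QuantumFieldTheory
open Literature.Probability.LatticeModels (Site TorusSite)
open Summit.QuantumFields.QCD.Cruxes.QuarkLoopCoefficient.Sketch.HeatSeries
open scoped Matrix ComplexConjugate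

variable {L : ℕ}

/-! ### §1 The covering map `π : ℤ⁴ → (ℤ/L)⁴` and its fibres -/

/-- The reduction `π z̃ = (z̃_ν mod L)_ν` commutes with unit shifts: `π (z̃ + e_μ) = π z̃ + e_μ`. -/
theorem castSite_add_single (z : Site 4) (μ : Fin 4) :
    (fun ν => (((z + Pi.single μ 1 : Site 4) ν : ℤ) : ZMod L)) =
      (fun ν => ((z ν : ℤ) : ZMod L)) + Pi.single μ 1 := by
  funext ν
  by_cases h : ν = μ
  · subst h; simp
  · simp [h]

/-- Backward shifts: `π (z̃ − e_μ) = w ↔ π z̃ = w + e_μ`. -/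
theorem castSite_sub_single_eq_iff (z : Site 4) (μ : Fin 4) (w : TorusSite 4 L) :
    (fun ν => (((z - Pi.single μ 1 : Site 4) ν : ℤ) : ZMod L)) = w ↔
      (fun ν => ((z ν : ℤ) : ZMod L)) = w + Pi.single μ 1 := by
  have h := castSite_add_single (L := L) (z - Pi.single μ 1) μ
  rw [sub_add_cancel] at h
  rw [h]
  constructor
  · intro e; rw [e]
  · intro e
    exact add_right_cancel (b := (Pi.single μ 1 : TorusSite 4 L)) e

/-- Deck translations do not change the reduction: `π (ỹ + L n) = π ỹ`. -/
theorem castSite_add_deck (y n : Site 4) :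
    (fun ν => (((y + fun μ => (L : ℤ) * n μ : Site 4) ν : ℤ) : ZMod L)) =
      fun ν => ((y ν : ℤ) : ZMod L) := by
  funext ν
  simp

/-- Two lifts of the same torus site differ by a deck translation. -/
theorem exists_deck_of_castSite_eq {z y : Site 4}
    (h : (fun ν => ((z ν : ℤ) : ZMod L)) = fun ν => ((y ν : ℤ) : ZMod L)) :
    ∃ n : Site 4, z = y + fun μ => (L : ℤ) * n μ := by
  have hd : ∀ ν, (L : ℤ) ∣ z ν - y ν := fun ν => by
    have := congrFun h ν
    exact (ZMod.intCast_eq_intCast_iff_dvd_sub (y ν) (z ν) L).mp this.symm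
  choose n hn using hd
  exact ⟨n, funext fun ν => by simp only [Pi.add_apply]; linarith [hn ν]⟩

/-- The deck translations act freely (for `L ≥ 1`). -/
theorem deck_injective [NeZero L] (y : Site 4) :
    Function.Injective (fun n : Site 4 => (y + fun μ => (L : ℤ) * n μ : Site 4)) := by
  intro n n' h
  funext μ
  have := congrFun h μ
  simp only [Pi.add_apply, add_right_inj] at this
  exact mul_left_cancel₀ (Int.natCast_ne_zero.mpr (NeZero.ne L)) this

/-- A double sum over the torus and over the fibres of a finite set of `ℤ⁴`-sites collapses to a
single sum over that set. -/
theorem sum_fibre_sum [NeZero L] {M : Type*} [AddCommMonoid M] (S : Finset (Site 4))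
    (f : Site 4 → TorusSite 4 L → M) :
    ∑ w : TorusSite 4 L, ∑ wt ∈ S.filter (fun wt => (fun ν => ((wt ν : ℤ) : ZMod L)) = w), f wt w =
      ∑ wt ∈ S, f wt (fun ν => ((wt ν : ℤ) : ZMod L)) := by
  rw [← Finset.sum_fiberwise S (fun wt : Site 4 => (fun ν => ((wt ν : ℤ) : ZMod L)))]
  refine Finset.sum_congr rfl fun w _ => Finset.sum_congr rfl fun wt hwt => ?_
  rw [(Finset.mem_filter.mp hwt).2]

/-! ### §2 The Wilson–Dirac matrix of a Cartan-diagonal field -/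

variable (U : GaugeConfig 4 L (Matrix.specialUnitaryGroup (Fin 3) ℂ))

/-- **Colour decoupling.** For a Cartan-diagonal field the massless `r = 1` Wilson–Dirac matrix is
colour-diagonal, and its colour-`a` block is the abelian Wilson kernel of the link phases
`u_a(e) = U(e)_{aa}` (the backward link `U(e)⁻¹_{aa} = (U(e)ᴴ)_{aa}` being `conj u_a(e)`). -/
theorem wilsonDirac_apply_diag
    (hdiag : ∀ (e : Edge 4 L) (i j : Fin 3), i ≠ j → (fundamentalRep (Fin 3)) (U e) i j = 0)
    (x : TorusSite 4 L) (a : Fin 3) (α : Fin 4) (y : TorusSite 4 L) (b : Fin 3) (β : Fin 4) :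
    wilsonDirac (fundamentalRep (Fin 3)) U 0 1 (x, a, α) (y, b, β) =
      if a = b then
        ((if x = y then (4 : ℂ) • (1 : Spin) else 0) -
          (1 / 2 : ℂ) • ∑ μ : Fin 4,
            ((if y = x + Pi.single μ 1 then
                (fundamentalRep (Fin 3) (U (x, μ)) a a) • ((1 : Spin) - euclideanGamma μ) else 0) +
              (if x = y + Pi.single μ 1 then
                conj (fundamentalRep (Fin 3) (U (y, μ)) a a) • ((1 : Spin) + euclideanGamma μ) else 0))) α β
      else 0 := by
  have hinv : ∀ (e : Edge 4 L) (i j : Fin 3),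
      fundamentalRep (Fin 3) (U e)⁻¹ i j = conj (fundamentalRep (Fin 3) (U e) j i) := fun _ _ _ => rfl
  simp only [wilsonDirac, Matrix.of_apply, hinv, Literature.MathematicalPhysics.QuantumFieldTheory.Site.shift]
  have h4 : ((((0 : ℝ) + 4 * (1 : ℝ) : ℝ)) : ℂ) = 4 := by push_cast; ring
  have h1 : (((1 : ℝ) : ℂ) • (1 : Matrix (Fin 4) (Fin 4) ℂ)) = 1 := by
    rw [Complex.ofReal_one, one_smul]
  rw [h4, h1]
  by_cases hab : a = b
  · subst hab
    rw [if_pos rfl, Matrix.sub_apply, Matrix.smul_apply, Matrix.sum_apply, smul_eq_mul]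
    congr 1
    · by_cases hxy : x = y
      · by_cases hαβ : α = β
        · subst hxy; subst hαβ; simp
        · subst hxy; simp [hαβ]
      · have hpq : ¬((x, a, α) = (y, a, β)) := fun e => hxy (Prod.mk.inj e).1
        simp [hpq, hxy]
    · congr 1
      refine Finset.sum_congr rfl fun μ _ => ?_
      rw [Matrix.add_apply]
      congr 1
      · split_ifs
        · simp [Matrix.sub_apply, mul_comm]
        · simp
      · split_ifs
        · simp [Matrix.add_apply, mul_comm]
        · simp
  · rw [if_neg hab]
    have h0 : ∀ μ : Fin 4, (fundamentalRep (Fin 3)) (U (x, μ)) a b = 0 := fun μ => hdiag _ _ _ hab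
    have h0' : ∀ μ : Fin 4, (U (y, μ) : Matrix (Fin 3) (Fin 3) ℂ) b a = 0 :=
      fun μ => hdiag _ _ _ (Ne.symm hab)
    have hpq : ¬((x, a, α) = (y, b, β)) := fun e => hab (Prod.mk.inj (Prod.mk.inj e).2).1
    simp [hpq, h0, h0']

/-! ### §3 Fibre identities for the Dirac kernel -/

/-- **Row fibre identity.** The `π z̃`-row of the torus abelian Wilson kernel of a link field `u` is
the fibre sum of the `z̃`-row of the `ℤ⁴` kernel of the pulled-back field `u ∘ π` (valid for every
`L`: each Kronecker delta on the torus is the fibre sum of the corresponding delta on `ℤ⁴`). -/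
theorem fibre_diracKer_row (u : Edge 4 L → ℂ) (zt : Site 4) (w : TorusSite 4 L) :
    ∑ wt ∈ (nbr zt).filter (fun wt => (fun ν => ((wt ν : ℤ) : ZMod L)) = w),
        diracKer (fun e => u ((fun ν => ((e.1 ν : ℤ) : ZMod L)), e.2)) zt wt =
      (if (fun ν => ((zt ν : ℤ) : ZMod L)) = w then (4 : ℂ) • (1 : Spin) else 0) -
        (1 / 2 : ℂ) • ∑ μ : Fin 4,
          ((if w = (fun ν => ((zt ν : ℤ) : ZMod L)) + Pi.single μ 1 then
              u ((fun ν => ((zt ν : ℤ) : ZMod L)), μ) • ((1 : Spin) - euclideanGamma μ) else 0) +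
            (if (fun ν => ((zt ν : ℤ) : ZMod L)) = w + Pi.single μ 1 then
              conj (u (w, μ)) • ((1 : Spin) + euclideanGamma μ) else 0)) := by
  have hmem : ∀ v : Site 4, v ∈ nbr zt →
      (v ∈ (nbr zt).filter (fun wt => (fun ν => ((wt ν : ℤ) : ZMod L)) = w) ↔
        (fun ν => ((v ν : ℤ) : ZMod L)) = w) := by
    intro v hv
    rw [Finset.mem_filter]
    exact ⟨fun h => h.2, fun h => ⟨hv, h⟩⟩
  unfold diracKer
  rw [Finset.sum_sub_distrib, ← Finset.smul_sum]
  congr 1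
  · rw [Finset.sum_ite_eq]
    by_cases h : (fun ν => ((zt ν : ℤ) : ZMod L)) = w
    · rw [if_pos ((hmem zt (self_mem_nbr zt)).mpr h), if_pos h]
    · rw [if_neg (fun h' => h ((hmem zt (self_mem_nbr zt)).mp h')), if_neg h]
  · congr 1
    rw [Finset.sum_comm]
    refine Finset.sum_congr rfl fun μ _ => ?_
    rw [Finset.sum_add_distrib]
    congr 1
    · -- forward hop: the delta sits at `z̃ + e_μ`
      rw [Finset.sum_ite_eq']
      have hiff : zt + Pi.single μ 1 ∈ (nbr zt).filter (fun wt => (fun ν => ((wt ν : ℤ) : ZMod L)) = w) ↔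
          w = (fun ν => ((zt ν : ℤ) : ZMod L)) + Pi.single μ 1 := by
        rw [hmem _ (add_single_mem_nbr zt μ), castSite_add_single, eq_comm]
      by_cases h : w = (fun ν => ((zt ν : ℤ) : ZMod L)) + Pi.single μ 1
      · rw [if_pos (hiff.mpr h), if_pos h]
      · rw [if_neg (fun h' => h (hiff.mp h')), if_neg h]
    · -- backward hop: the delta sits at `z̃ − e_μ`
      have hre : ∀ wt : Site 4, (zt = wt + Pi.single μ 1) ↔ (zt - Pi.single μ 1 = wt) := by
        intro wt; constructor
        · intro e; rw [e, add_sub_cancel_right]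
        · intro e; rw [← e, sub_add_cancel]
      simp only [hre]
      rw [Finset.sum_ite_eq]
      have hiff : zt - Pi.single μ 1 ∈ (nbr zt).filter (fun wt => (fun ν => ((wt ν : ℤ) : ZMod L)) = w) ↔
          (fun ν => ((zt ν : ℤ) : ZMod L)) = w + Pi.single μ 1 := by
        rw [hmem _ (sub_single_mem_nbr zt μ), castSite_sub_single_eq_iff]
      by_cases h : (fun ν => ((zt ν : ℤ) : ZMod L)) = w + Pi.single μ 1
      · rw [if_pos (hiff.mpr h), if_pos h]
        have hw : (fun ν => (((zt - Pi.single μ 1 : Site 4) ν : ℤ) : ZMod L)) = w :=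
          (castSite_sub_single_eq_iff zt μ w).mpr h
        simp only [hw]
      · rw [if_neg (fun h' => h (hiff.mp h')), if_neg h]

/-- **Column fibre identity.** The `π x̃`-column of the torus abelian Wilson kernel is the fibre sum
of the `x̃`-column of the `ℤ⁴` kernel of the pulled-back field. -/
theorem fibre_diracKer_col (u : Edge 4 L → ℂ) (xt : Site 4) (z : TorusSite 4 L) :
    ∑ zt ∈ (nbr xt).filter (fun zt => (fun ν => ((zt ν : ℤ) : ZMod L)) = z),
        diracKer (fun e => u ((fun ν => ((e.1 ν : ℤ) : ZMod L)), e.2)) zt xt =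
      (if z = (fun ν => ((xt ν : ℤ) : ZMod L)) then (4 : ℂ) • (1 : Spin) else 0) -
        (1 / 2 : ℂ) • ∑ μ : Fin 4,
          ((if (fun ν => ((xt ν : ℤ) : ZMod L)) = z + Pi.single μ 1 then
              u (z, μ) • ((1 : Spin) - euclideanGamma μ) else 0) +
            (if z = (fun ν => ((xt ν : ℤ) : ZMod L)) + Pi.single μ 1 then
              conj (u ((fun ν => ((xt ν : ℤ) : ZMod L)), μ)) • ((1 : Spin) + euclideanGamma μ) else 0)) := by
  have hmem : ∀ v : Site 4, v ∈ nbr xt →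
      (v ∈ (nbr xt).filter (fun zt => (fun ν => ((zt ν : ℤ) : ZMod L)) = z) ↔
        (fun ν => ((v ν : ℤ) : ZMod L)) = z) := by
    intro v hv
    rw [Finset.mem_filter]
    exact ⟨fun h => h.2, fun h => ⟨hv, h⟩⟩
  unfold diracKer
  rw [Finset.sum_sub_distrib, ← Finset.smul_sum]
  congr 1
  · rw [Finset.sum_ite_eq']
    by_cases h : z = (fun ν => ((xt ν : ℤ) : ZMod L))
    · rw [if_pos ((hmem xt (self_mem_nbr xt)).mpr h.symm), if_pos h]
    · rw [if_neg (fun h' => h ((hmem xt (self_mem_nbr xt)).mp h').symm), if_neg h]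
  · congr 1
    rw [Finset.sum_comm]
    refine Finset.sum_congr rfl fun μ _ => ?_
    rw [Finset.sum_add_distrib]
    congr 1
    · -- forward hop into `x̃`: the delta sits at `x̃ − e_μ`
      have hre : ∀ zt : Site 4, (xt = zt + Pi.single μ 1) ↔ (xt - Pi.single μ 1 = zt) := by
        intro zt; constructor
        · intro e; rw [e, add_sub_cancel_right]
        · intro e; rw [← e, sub_add_cancel]
      simp only [hre]
      rw [Finset.sum_ite_eq]
      have hiff : xt - Pi.single μ 1 ∈ (nbr xt).filter (fun zt => (fun ν => ((zt ν : ℤ) : ZMod L)) = z) ↔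
          (fun ν => ((xt ν : ℤ) : ZMod L)) = z + Pi.single μ 1 := by
        rw [hmem _ (sub_single_mem_nbr xt μ), castSite_sub_single_eq_iff]
      by_cases h : (fun ν => ((xt ν : ℤ) : ZMod L)) = z + Pi.single μ 1
      · rw [if_pos (hiff.mpr h), if_pos h]
        have hz : (fun ν => (((xt - Pi.single μ 1 : Site 4) ν : ℤ) : ZMod L)) = z :=
          (castSite_sub_single_eq_iff xt μ z).mpr h
        simp only [hz]
      · rw [if_neg (fun h' => h (hiff.mp h')), if_neg h]
    · -- backward hop out of `x̃`: the delta sits at `x̃ + e_μ`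
      have hre : ∀ zt : Site 4, (zt = xt + Pi.single μ 1) ↔ (xt + Pi.single μ 1 = zt) :=
        fun zt => eq_comm
      simp only [hre]
      rw [Finset.sum_ite_eq]
      have hiff : xt + Pi.single μ 1 ∈ (nbr xt).filter (fun zt => (fun ν => ((zt ν : ℤ) : ZMod L)) = z) ↔
          z = (fun ν => ((xt ν : ℤ) : ZMod L)) + Pi.single μ 1 := by
        rw [hmem _ (add_single_mem_nbr xt μ), castSite_add_single, eq_comm]
      by_cases h : z = (fun ν => ((xt ν : ℤ) : ZMod L)) + Pi.single μ 1
      · rw [if_pos (hiff.mpr h), if_pos h]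
      · rw [if_neg (fun h' => h (hiff.mp h')), if_neg h]

/-- **Row form of colour decoupling + periodization**: the `(π z̃, a)`-row of the torus Wilson–Dirac
matrix of a Cartan-diagonal field is the fibre sum of the `z̃`-row of `diracKer ũ_a`. -/
theorem wilsonDirac_row
    (hdiag : ∀ (e : Edge 4 L) (i j : Fin 3), i ≠ j → (fundamentalRep (Fin 3)) (U e) i j = 0)
    (zt : Site 4) (a : Fin 3) (γ : Fin 4) (w : TorusSite 4 L) (b : Fin 3) (β : Fin 4) :
    wilsonDirac (fundamentalRep (Fin 3)) U 0 1 ((fun ν => ((zt ν : ℤ) : ZMod L)), a, γ) (w, b, β) =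
      if a = b then
        (∑ wt ∈ (nbr zt).filter (fun wt => (fun ν => ((wt ν : ℤ) : ZMod L)) = w),
          diracKer (fun e => (fundamentalRep (Fin 3)) (U ((fun ν => ((e.1 ν : ℤ) : ZMod L)), e.2)) a a)
            zt wt) γ β
      else 0 := by
  rw [wilsonDirac_apply_diag U hdiag,
    fibre_diracKer_row (fun e => (fundamentalRep (Fin 3)) (U e) a a) zt w]

/-- **Column form of colour decoupling + periodization**: the `(π x̃, a)`-column of the torus
Wilson–Dirac matrix of a Cartan-diagonal field is the fibre sum of the `x̃`-column of `diracKer ũ_a`. -/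
theorem wilsonDirac_col
    (hdiag : ∀ (e : Edge 4 L) (i j : Fin 3), i ≠ j → (fundamentalRep (Fin 3)) (U e) i j = 0)
    (z : TorusSite 4 L) (c : Fin 3) (γ : Fin 4) (xt : Site 4) (a : Fin 3) (α : Fin 4) :
    wilsonDirac (fundamentalRep (Fin 3)) U 0 1 (z, c, γ) ((fun ν => ((xt ν : ℤ) : ZMod L)), a, α) =
      if c = a then
        (∑ zt ∈ (nbr xt).filter (fun zt => (fun ν => ((zt ν : ℤ) : ZMod L)) = z),
          diracKer (fun e => (fundamentalRep (Fin 3)) (U ((fun ν => ((e.1 ν : ℤ) : ZMod L)), e.2)) a a)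
            zt xt) γ α
      else 0 := by
  rw [wilsonDirac_apply_diag U hdiag]
  by_cases hca : c = a
  · subst hca
    rw [if_pos rfl, if_pos rfl, fibre_diracKer_col (fun e => (fundamentalRep (Fin 3)) (U e) c c) xt z]
  · rw [if_neg hca, if_neg hca]

/-! ### Registered headline -/

/-- Registered headline of this helper file (aux stub `stub_torusToPlaneAuxC` of crux
stmt-QuantumFields-16786, line `Sketch`): colour decoupling and row periodization of the torus
Wilson–Dirac matrix of a Cartan-diagonal field. -/
theorem stub_torusToPlaneAuxC :
    ∀ (L : ℕ) (U : GaugeConfig 4 L (Matrix.specialUnitaryGroup (Fin 3) ℂ)),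
      (∀ (e : Edge 4 L) (i j : Fin 3), i ≠ j → (fundamentalRep (Fin 3)) (U e) i j = 0) →
      ∀ (zt : Site 4) (a : Fin 3) (γ : Fin 4) (w : TorusSite 4 L) (b : Fin 3) (β : Fin 4),
        wilsonDirac (fundamentalRep (Fin 3)) U 0 1 ((fun ν => ((zt ν : ℤ) : ZMod L)), a, γ) (w, b, β) =
          if a = b then
            (∑ wt ∈ (nbr zt).filter (fun wt => (fun ν => ((wt ν : ℤ) : ZMod L)) = w),
              diracKer (fun e => (fundamentalRep (Fin 3)) (U ((fun ν => ((e.1 ν : ℤ) : ZMod L)), e.2)) a a)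
                zt wt) γ β
          else 0 :=
  fun _ U hdiag => wilsonDirac_row U hdiag

end Summit.QuantumFields.QCD.Cruxes.QuarkLoopCoefficient.Sketch.TorusToPlane

end
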